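import Mathlib
import HarnessLib
import Summits.Langlands.Langlands.Statement
import Summits.Langlands.Langlands.Theorems.IrreducibilityBySelfDualityIrreducibleOffSectorCliffordGalois
import Literature.NumberTheory.Automorphic.ReciprocityGLnPatchingFamily
import Literature.NumberTheory.Automorphic.QuadraticBaseChangeNonSelfTwistProofs
import Literature.NumberTheory.GaloisRepresentations.GaloisRepUnramifiedProofs

/-!
# A CM quadratic extension keeping `ρ` irreducible (crux `ReciprocityTRCM`, stmt-Langlands-1093, line
# `pieces`; `--supports` file for the registered stubs 5E `stub_exists_goodCMQuadratic` /
# `stub_exists_CMQuadratic_isIrreducible_restrictField`)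

Support file (closes nothing).  Stub 5E of the checked skeleton `Cruxes/ReciprocityTRCM/Lines/pieces.lean`
asks, for `F` totally real and `ρ : Γ_F → GL_n(ℚ̄_ℓ)` irreducible and pinned-geometric, for a quadratic CM
extension `E/F` with `ρ|_{Γ_E}` irreducible AND pinned-geometric over `E`.  This file PROVES the Galois
half — the registered stub `stub_exists_CMQuadratic_isIrreducible_restrictField`, in every rank `n ≥ 1` —
and the almost-everywhere-unramified half of the geometricity restriction, and isolates the de Rham clause
at `w ∣ ℓ` as the exact formal residue:

* `ker_eq_of_index_eq_two` — a non-trivial character trivial on an index-`2` subgroup has that subgroup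
  as its kernel;
* `exists_selfTwist_of_not_isIrreducible_restrictField` — **Clifford, index `2`, every rank**: for `E/K`
  quadratic (`char K = 0`) and `ρ` irreducible with `ρ|_{Γ_E}` reducible there is a self-twist
  `ρ ⊗ χ ≅ ρ` with `ker χ = res(Γ_E)` EXACTLY (the landed dichotomy
  `IrreducibleOffSector.isIrreducible_restrictField_or_exists_selfTwist` + the index computation
  `SorensenPatching.index_range_absGaloisRestrict`);
* `finite_setOf_ker_selfTwist` — the kernels of the self-twist characters of a rank-`n ≥ 1` `ρ` form a
  finite set of subgroups of `Γ_K` (at most `n²` self-twists,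
  `Representation.card_le_finrank_sq_of_forall_twist_equiv`);
* `infinite_setOf_range_sqrtNegField_isIrreducible` — hence, in Sorensen's `∅`-general family
  `K(√-D)`, `D ∈ GoodPrime K m X` (`SGeneralQuadraticFamily`), for EVERY finite place `v` of `K` there are
  infinitely many members (pairwise distinct subgroups `res(Γ_{K(√-D)})`) in which `v` splits completely
  AND `ρ|_{Γ_{K(√-D)}}` stays irreducible (`GoodPrime.sGeneral` minus a finite set);
  `exists_goodPrime_isIrreducible_restrictField`;
* `stub_exists_CMQuadratic_isIrreducible_restrictField` — the REGISTERED Galois half: `F` totally real ⇒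
  the member `F(√-D)` is CM (`GoodPrime.isCMField`), quadratic, Galois;
* `eventually_isUnramifiedAt_restrictField` — a.e. unramifiedness restricts to `Γ_E`
  (`FramedGaloisRep.isUnramifiedAt_restrictField` + finiteness of the fibres of `w ↦ w ∩ 𝓞 F`);
* `isGeometricFramed_restrictField_of_finite_range`, `stub_exists_goodCMQuadratic_of_finite_range` —
  the FINITE-IMAGE SECTOR of the full stub, unconditionally: finite-image local representations are de
  Rham for THE pinned datum (`fontainePstAdicCompletion_isDeRhamFramed_of_finite_range`, D1: its period
  ring is `B_dR(E_w)`), and `ρ|_{Γ_E}` has finite image with `ρ`;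
* `isGeometricFramed_restrictField_of_isUnramifiedAt_above`,
  `stub_exists_goodCMQuadratic_of_isUnramifiedAt_above` — the UNRAMIFIED-ABOVE-`ℓ` SECTOR, for every
  datum: `ρ` unramified at every `v ∣ ℓ` ⇒ `ρ|_{Γ_E}` unramified at every `w ∣ ℓ` ⇒ locally unramified
  (proved bridge `GaloisRep.isUnramifiedAt_iff_toLocal_holds`) ⇒ de Rham (structure axiom
  `isDeRhamWith_of_isLocallyUnramified` of `PstWeilDeligneData`);
* `stub_exists_goodCMQuadratic_of_deRhamRestriction` — the FULL registered signature of 5E from ONE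
  explicit hypothesis, the missing base-change lemma for the pinned Fontaine datum: "de Rham at every
  `v ∣ ℓ` over `F` ⇒ de Rham at every `w ∣ ℓ` over `E` for `ρ|_{Γ_E}`".  Nothing in the tree relates
  `fontainePstAdicCompletion w ℓ hw` (`B_dR(E_w)`, built from `Ē_w`) to `fontainePstAdicCompletion v ℓ hv`
  (`B_dR(F_v)`), nor `Γ_{E_w} → Γ_E → Γ_F` to `Γ_{E_w} → Γ_{F_v} → Γ_F`; this is the formal residue of 5E
  (definition item `defn-FontainePstWeilDeligneData`, D2, or a `B_dR` base-change clause).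

No definitions, no named facts, no `sorry`; standard axioms.

## References
* A. H. Clifford, Ann. of Math. 38 (1937), Thm. 1. [Clifford1937]
* C. M. Sorensen, *A patching lemma*, LMS Lecture Note Ser. 457 (2020), §1 Example. [Sorensen2020]
* M. Harris, K.-W. Lan, R. Taylor, J. Thorne, Res. Math. Sci. 3:37 (2016), §1 p. 11, proof of Cor. 7.14.
  [HarrisLanTaylorThorneRMS2016]
* J.-M. Fontaine, Astérisque 223 (1994), Exp. III §1.5, §3. [FontaineAsterisque223III]
* J.-M. Fontaine, B. Mazur, *Geometric Galois representations* (1995), §1. [FontaineMazurGeometric1995]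
* J.-P. Serre, *Abelian ℓ-adic representations* (1968), Ch. I §2.1. [SerreAbelianLadic1968]
* J. Neukirch, *Algebraic Number Theory* (1999), Ch. II §9 Prop. (9.6). [NeukirchANT1999]
-/

noncomputable section

set_option linter.dupNamespace false -- project-wide option; `Summit.Langlands.Langlands` is the mandated namespace

open scoped MatrixGroups Matrix NumberField Classical
open Filter IsDedekindDomain Field NumberField
open Literature.NumberTheory.Automorphic Literature.NumberTheory.GaloisRepresentations
open Literature.NumberTheory.GaloisRepresentations.QuadraticFamily
open Literature.NumberTheory.PAdicHodge
open Literature.RepresentationTheory.Semisimple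
open Summit.Langlands

namespace Summit.Langlands.Langlands.Theorems.ReciprocityTRCM

/-! ## 1. Index two -/

section IndexTwo

variable {G M : Type*} [Group G] [Group M]

/-- **A non-trivial homomorphism trivial on a subgroup of index `2` has exactly that subgroup as its
kernel** (an index-`2` subgroup is maximal: with `a ∉ H`, every `b` has `b ∈ H` or `b a ∈ H`, Mathlib
`Subgroup.index_eq_two_iff_exists_notMem_and`). [folklore] -/
theorem ker_eq_of_index_eq_two {H : Subgroup G} (hH : H.index = 2) (χ : G →* M)
    (hχH : ∀ h ∈ H, χ h = 1) (hχ : χ ≠ 1) : χ.ker = H := by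
  obtain ⟨a, -, ha⟩ := Subgroup.index_eq_two_iff_exists_notMem_and.mp hH
  refine le_antisymm (fun b hb ↦ ?_) (fun h hh ↦ hχH h hh)
  by_contra hbH
  have hba : b * a ∈ H := (ha b).resolve_right hbH
  have hχa : χ a = 1 := by
    have h1 := hχH _ hba
    rwa [map_mul, show χ b = 1 from hb, one_mul] at h1
  refine hχ (MonoidHom.ext fun g ↦ ?_)
  rw [MonoidHom.one_apply]
  rcases ha g with hg | hg
  · have h1 := hχH _ hg
    rwa [map_mul, hχa, mul_one] at h1
  · exact hχH g hg

end IndexTwo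

/-! ## 2. Self-twists cut out by quadratic extensions (Clifford, index `2`, every rank) -/

section SelfTwist

variable {K : Type} [Field K] {ℓ : ℕ} [Fact ℓ.Prime] {n : ℕ}

/-- **Clifford for a quadratic extension, every rank.**  Let `E/K` be quadratic (`char K = 0`) and
`ρ : Γ_K → GL_n(ℚ̄_ℓ)` continuous with irreducible underlying representation whose restriction
`ρ|_{Γ_E}` is REDUCIBLE.  Then `ρ ⊗ χ ≅ ρ` for a character `χ : Γ_K → ℚ̄_ℓˣ` with `ker χ = res(Γ_E)`
exactly (the quadratic character of `E/K`): the landed dichotomy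
`IrreducibleOffSector.isIrreducible_restrictField_or_exists_selfTwist` (Clifford 1937 Thm. 1 along the cyclic
presentation of `Γ_K ⊇ res(Γ_E)`) gives `χ ≠ 1` trivial on `res(Γ_E)`, which has index `[E:K] = 2`
(`SorensenPatching.index_range_absGaloisRestrict`), so `ker χ = res(Γ_E)` (`ker_eq_of_index_eq_two`).
[cite: Clifford1937, Thm. 1] -/
theorem exists_selfTwist_of_not_isIrreducible_restrictField [CharZero K] (E : Type) [Field E]
    [Algebra K E] (hdeg : Module.finrank K E = 2) (ρ : FramedGaloisRep K (PadicAlgCl ℓ) n)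
    (hirr : ρ.toGaloisRep.IsIrreducible) (hred : ¬ (ρ.restrictField E).toGaloisRep.IsIrreducible) :
    ∃ χ : absoluteGaloisGroup K →* (PadicAlgCl ℓ)ˣ,
      χ.ker = (absGaloisRestrict K E).range ∧
        Nonempty ((Representation.twist (FramedRep.toRepresentation ρ) χ).Equiv
          (FramedRep.toRepresentation ρ)) := by
  haveI : FiniteDimensional K E := Module.finite_of_finrank_pos (by rw [hdeg]; exact two_pos)
  haveI : Algebra.IsQuadraticExtension K E := ⟨hdeg⟩
  haveI : IsGalois K E := inferInstance
  rcases IrreducibleOffSector.isIrreducible_restrictField_or_exists_selfTwist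
      (inferInstance : IsCyclic (E ≃ₐ[K] E)) ρ hirr with h | ⟨χ, hχH, hχ1, -, ⟨e⟩⟩
  · exact absurd h hred
  · refine ⟨χ, ker_eq_of_index_eq_two ?_ χ hχH hχ1, ⟨e.symm⟩⟩
    rw [SorensenPatching.index_range_absGaloisRestrict K E, hdeg]

/-- **The kernels of the self-twist characters of `ρ` form a finite set** (`n ≥ 1`): a rank-`n`
representation has at most `n²` self-twists `ρ ⊗ χ ≅ ρ`
(`Representation.card_le_finrank_sq_of_forall_twist_equiv`: the intertwiners are linearly independent in
`End(ℚ̄_ℓⁿ)`), and `χ ↦ ker χ` maps them onto the set in question. [folklore] -/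
theorem finite_setOf_ker_selfTwist (hn : 0 < n) (ρ : FramedGaloisRep K (PadicAlgCl ℓ) n) :
    {H : Subgroup (absoluteGaloisGroup K) | ∃ χ : absoluteGaloisGroup K →* (PadicAlgCl ℓ)ˣ,
      χ.ker = H ∧ Nonempty ((Representation.twist (FramedRep.toRepresentation ρ) χ).Equiv
        (FramedRep.toRepresentation ρ))}.Finite := by
  set T : Set (absoluteGaloisGroup K →* (PadicAlgCl ℓ)ˣ) :=
    {χ | Nonempty ((Representation.twist (FramedRep.toRepresentation ρ) χ).Equiv
      (FramedRep.toRepresentation ρ))} with hT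
  have hTfin : T.Finite := by
    by_contra hinf
    obtain ⟨s, hsT, hscard⟩ := Set.Infinite.exists_subset_card_eq hinf (n ^ 2 + 1)
    haveI : Nonempty (Fin n) := ⟨⟨0, hn⟩⟩
    haveI : Nontrivial (Fin n → PadicAlgCl ℓ) := inferInstance
    have hle := Representation.card_le_finrank_sq_of_forall_twist_equiv
      (FramedRep.toRepresentation ρ) s (fun χ hχ ↦ hsT hχ)
    rw [Module.finrank_fin_fun, hscard] at hle
    omega
  refine (hTfin.image MonoidHom.ker).subset ?_
  rintro H ⟨χ, rfl, hχ⟩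
  exact ⟨χ, hχ, rfl⟩

end SelfTwist

/-! ## 3. Good primes keeping `ρ` irreducible -/

section Family

variable {K : Type} [Field K] [NumberField K] {ℓ : ℕ} [Fact ℓ.Prime] {n : ℕ}

/-- **Infinitely many members of Sorensen's family keep `ρ` irreducible, with a prescribed place split.**
For `ρ : Γ_K → GL_n(ℚ̄_ℓ)` (`n ≥ 1`) with irreducible underlying representation, every modulus `m ≠ 0`,
every finite set `X` of excluded primes and EVERY finite place `v` of `K`, the set of subgroups
`res(Γ_{K(√-D)}) ≤ Γ_K`, `D ∈ GoodPrime K m X`, in which `v` splits completely AND for which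
`ρ|_{Γ_{K(√-D)}}` is irreducible, is infinite: `GoodPrime.sGeneral` (an infinite set of subgroups) minus the
finite set of kernels of self-twists (`finite_setOf_ker_selfTwist`), by Clifford
(`exists_selfTwist_of_not_isIrreducible_restrictField`).  The Galois side of "`π ≇ π ⊗ η_{E/K}` for all
but finitely many quadratic `E`" (Arthur–Clozel Ch. 3 Thm. 4.2 / Sorensen's finitely many exclusions `X`).
[cite: Sorensen2020, §1 Def. 1 and Example] [cite: Clifford1937, Thm. 1] -/
theorem infinite_setOf_range_sqrtNegField_isIrreducible (hn : 0 < n)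
    (ρ : FramedGaloisRep K (PadicAlgCl ℓ) n) (hirr : ρ.toGaloisRep.IsIrreducible)
    (m : ℕ) (hm : m ≠ 0) (X : Set ℕ) (hX : X.Finite) (v : HeightOneSpectrum (𝓞 K)) :
    {H : Subgroup (absoluteGaloisGroup K) | ∃ i : GoodPrime K m X,
      H = (absGaloisRestrict K (sqrtNegField K i.1)).range ∧
      (v.asIdeal.primesOver (𝓞 (sqrtNegField K i.1))).ncard =
        Module.finrank K (sqrtNegField K i.1) ∧
      (ρ.restrictField (sqrtNegField K i.1)).toGaloisRep.IsIrreducible}.Infinite := by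
  refine ((GoodPrime.sGeneral K m X hm hX v).sdiff (finite_setOf_ker_selfTwist hn ρ)).mono ?_
  rintro H ⟨⟨i, rfl, hsplit⟩, hH⟩
  refine ⟨i, rfl, hsplit, ?_⟩
  by_contra hred
  obtain ⟨χ, hker, hχ⟩ := exists_selfTwist_of_not_isIrreducible_restrictField
    (sqrtNegField K i.1) finrank_sqrtNegField ρ hirr hred
  exact hH ⟨χ, hker, hχ⟩

/-- **Some member `K(√-D)`, `D ∈ GoodPrime K m X`, keeps `ρ` irreducible** (`n ≥ 1`, `m ≠ 0`, `X`
finite). [cite: Clifford1937, Thm. 1] -/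
theorem exists_goodPrime_isIrreducible_restrictField (hn : 0 < n)
    (ρ : FramedGaloisRep K (PadicAlgCl ℓ) n) (hirr : ρ.toGaloisRep.IsIrreducible)
    (m : ℕ) (hm : m ≠ 0) (X : Set ℕ) (hX : X.Finite) :
    ∃ i : GoodPrime K m X, (ρ.restrictField (sqrtNegField K i.1)).toGaloisRep.IsIrreducible := by
  haveI := SorensenPatching.infinite_heightOneSpectrum K
  obtain ⟨v⟩ := (inferInstance : Nonempty (HeightOneSpectrum (𝓞 K)))
  obtain ⟨H, i, -, -, hi⟩ :=
    (infinite_setOf_range_sqrtNegField_isIrreducible hn ρ hirr m hm X hX v).nonempty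
  exact ⟨i, hi⟩

end Family

/-! ## 4. The registered Galois half of stub 5E -/

/-- **STUB 5E, Galois half (registered `stub_exists_CMQuadratic_isIrreducible_restrictField`)**: for `F`
totally real, `n ≥ 1` and `ρ : Γ_F → GL_n(ℚ̄_ℓ)` with irreducible underlying representation there is a
quadratic (hence Galois) CM extension `E/F` with `ρ|_{Γ_E}` irreducible — a member `E = F(√-D)` of
Sorensen's family (`exists_goodPrime_isIrreducible_restrictField`; CM by `GoodPrime.isCMField`,
`[E:F] = 2` by `finrank_sqrtNegField`). [cite: Clifford1937, Thm. 1]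
[cite: HarrisLanTaylorThorneRMS2016, §1 (p. 11) and proof of Cor. 7.14 (p. 232)] -/
theorem stub_exists_CMQuadratic_isIrreducible_restrictField : ∀ (F : Type) [Field F] [NumberField F], NumberField.IsTotallyReal F → ∀ (n : ℕ), 0 < n → ∀ (ℓ : ℕ) [Fact ℓ.Prime] (ρ : Literature.NumberTheory.GaloisRepresentations.FramedGaloisRep F (PadicAlgCl ℓ) n), ρ.toGaloisRep.IsIrreducible → ∃ (E : Type) (_ : Field E) (_ : NumberField E) (_ : Algebra F E) (_ : IsGalois F E), Module.finrank F E = 2 ∧ NumberField.IsCMField E ∧ (ρ.restrictField E).toGaloisRep.IsIrreducible := by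
  intro F _ _ hF n hn ℓ _ ρ hirr
  obtain ⟨i, hi⟩ :=
    exists_goodPrime_isIrreducible_restrictField hn ρ hirr 1 one_ne_zero ∅ Set.finite_empty
  exact ⟨sqrtNegField F i.1, inferInstance, inferInstance, inferInstance, inferInstance,
    finrank_sqrtNegField, i.isCMField (Or.inl hF), hi⟩

/-! ## 5. Restriction of pinned geometricity: the a.e.-unramified half, the finite-image sector, and the
de Rham residue -/

section Geometric

variable {F : Type} [Field F] [NumberField F] {ℓ : ℕ} [Fact ℓ.Prime] {n : ℕ}

/-- **Almost-everywhere unramifiedness restricts**: if `ρ` is unramified at all but finitely many places of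
`F`, then `ρ|_{Γ_E}` is unramified at all but finitely many places of `E` (inertia at `𝔔 ∣ w` restricts
into inertia at `ι⁻¹(𝔔) ∣ w ∩ 𝓞 F`, `FramedGaloisRep.isUnramifiedAt_restrictField`; the finitely many bad
`v` lie below finitely many `w`, `eventually_under`). [cite: SerreAbelianLadic1968, Ch. I §2.1] -/
theorem eventually_isUnramifiedAt_restrictField (E : Type) [Field E] [NumberField E] [Algebra F E]
    {A : Type*} [CommRing A] [TopologicalSpace A] (ρ : FramedGaloisRep F A n)
    (h : ∀ᶠ v : HeightOneSpectrum (𝓞 F) in cofinite, ρ.IsUnramifiedAt v) :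
    ∀ᶠ w : HeightOneSpectrum (𝓞 E) in cofinite, (ρ.restrictField E).IsUnramifiedAt w := by
  filter_upwards [eventually_under (E := E) h] with w hw
  exact ρ.isUnramifiedAt_restrictField (v := w.under (𝓞 F)) rfl (hw _ rfl)

omit [NumberField F] in
/-- The localisation at `w` of the restriction of a finite-image `ρ` has finite image
(`(ρ|_{Γ_E})|_{Γ_{E_w}} = ρ ∘ res ∘ res`). [folklore] -/
theorem finite_range_toLocal_restrictField (E : Type) [Field E] [NumberField E] [Algebra F E]
    {A : Type*} [CommRing A] [TopologicalSpace A] (ρ : FramedGaloisRep F A n)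
    (hfin : (Set.range ρ).Finite) (w : HeightOneSpectrum (𝓞 E)) :
    (Set.range ((ρ.restrictField E).toLocal w)).Finite := by
  refine hfin.subset ?_
  rintro _ ⟨σ, rfl⟩
  exact ⟨_, rfl⟩

/-- **Finite-image sector: pinned geometricity restricts, for EVERY reciprocity datum of `E`,
unconditionally.**  If `ρ : Γ_F → GL_n(ℚ̄_ℓ)` has finite image and is unramified almost everywhere, then
`ρ|_{Γ_E}` is pinned-geometric over `E`: a.e. unramified (`eventually_isUnramifiedAt_restrictField`) and de
Rham at EVERY `w ∣ ℓ` for THE datum `R'.pst ℓ w hw = fontainePstAdicCompletion w ℓ hw`, whose period ring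
is `B_dR(E_w)` (D1) and for which finite-image representations are de Rham
(`fontainePstAdicCompletion_isDeRhamFramed_of_finite_range`).
[cite: FontaineAsterisque223III, Exp. III §1.5 and §3] [cite: FontaineMazurGeometric1995, §1] -/
theorem isGeometricFramed_restrictField_of_finite_range (E : Type) [Field E] [NumberField E]
    [Algebra F E] (ρ : FramedGaloisRep F (PadicAlgCl ℓ) n) (hfin : (Set.range ρ).Finite)
    (hunr : ∀ᶠ v : HeightOneSpectrum (𝓞 F) in cofinite, ρ.IsUnramifiedAt v)
    (R' : ReciprocityData E) : IsGeometricFramed R' (ρ.restrictField E) :=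
  ⟨eventually_isUnramifiedAt_restrictField E ρ hunr, fun w hw ↦
    fontainePstAdicCompletion_isDeRhamFramed_of_finite_range w ℓ hw _
      (finite_range_toLocal_restrictField E ρ hfin w)⟩

/-- **STUB 5E on the finite-image sector, unconditionally** (the registered signature of
`stub_exists_goodCMQuadratic` with the extra hypothesis `(Set.range ρ).Finite`, e.g. Artin-type `ρ`):
the CM quadratic `E = F(√-D)` of `stub_exists_CMQuadratic_isIrreducible_restrictField` keeps `ρ` irreducible, and
`ρ|_{Γ_E}` is pinned-geometric for every `R'` (`isGeometricFramed_restrictField_of_finite_range`).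
[cite: FontaineMazurGeometric1995, §1] [cite: Clifford1937, Thm. 1] -/
theorem stub_exists_goodCMQuadratic_of_finite_range : ∀ (F : Type) [Field F] [NumberField F], NumberField.IsTotallyReal F → ∀ (R : ReciprocityData F) (n : ℕ), 0 < n → ∀ (ℓ : ℕ) [Fact ℓ.Prime] (ρ : Literature.NumberTheory.GaloisRepresentations.FramedGaloisRep F (PadicAlgCl ℓ) n), ρ.toGaloisRep.IsIrreducible → IsGeometricFramed R ρ → (Set.range ρ).Finite → ∃ (E : Type) (_ : Field E) (_ : NumberField E) (_ : Algebra F E) (_ : IsGalois F E), Module.finrank F E = 2 ∧ NumberField.IsCMField E ∧ (ρ.restrictField E).toGaloisRep.IsIrreducible ∧ ∀ R' : ReciprocityData E, IsGeometricFramed R' (ρ.restrictField E) := by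
  intro F _ _ hF R n hn ℓ _ ρ hirr hgeo hfin
  obtain ⟨i, hi⟩ :=
    exists_goodPrime_isIrreducible_restrictField hn ρ hirr 1 one_ne_zero ∅ Set.finite_empty
  exact ⟨sqrtNegField F i.1, inferInstance, inferInstance, inferInstance, inferInstance,
    finrank_sqrtNegField, i.isCMField (Or.inl hF), hi,
    isGeometricFramed_restrictField_of_finite_range _ ρ hfin hgeo.1⟩

/-- **Local unramifiedness from global**: if `ρ` is unramified at `v` then `ρ|_{Γ_{K_v}}` kills the
inertia group of the local field `K_v` (proved bridge `GaloisRep.isUnramifiedAt_iff_toLocal_holds`,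
un-framed, transported through the faithful standard representation).
[cite: NeukirchANT1999, Ch. II §9 Prop. (9.6)] [cite: SerreAbelianLadic1968, Ch. I §2.1] -/
theorem isLocallyUnramified_toLocal_of_isUnramifiedAt {K : Type} [Field K] [NumberField K]
    (ρ : FramedGaloisRep K (PadicAlgCl ℓ) n) (v : HeightOneSpectrum (𝓞 K))
    (h : ρ.IsUnramifiedAt v) : (ρ.toLocal v).IsLocallyUnramified := by
  -- adapted from `isLocallyUnramified_toLocal_of_isUnramifiedAt` (Cruxes/IcosahedralSupply/Disproof.lean, `K = ℚ`)
  intro σ hσ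
  have h1 := ((GaloisRep.isUnramifiedAt_iff_toLocal_holds v ρ.toGaloisRep).1
    ((FramedGaloisRep.isUnramifiedAt_toGaloisRep_iff v ρ).2 h)) σ hσ
  rw [GaloisRep.toLocal_apply] at h1
  rw [FramedGaloisRep.toLocal_apply]
  have h2 : Matrix.toLin' ((ρ (absGaloisRestrict K (v.adicCompletion K) σ) :
      GL (Fin n) (PadicAlgCl ℓ)) : Matrix (Fin n) (Fin n) (PadicAlgCl ℓ)) = Matrix.toLin' 1 := by
    rw [Matrix.toLin'_one]
    refine LinearMap.ext fun x => ?_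
    simpa using congr($h1 x)
  exact Units.ext (Matrix.toLin'.injective h2)

omit [NumberField F] in
/-- A rational prime in `w` lies in the place `w ∩ 𝓞 F` below `w`. [folklore] -/
theorem natCast_mem_under (E : Type) [Field E] [NumberField E] [Algebra F E]
    (w : HeightOneSpectrum (𝓞 E)) {q : ℕ} (hw : ((q : ℕ) : 𝓞 E) ∈ w.asIdeal) :
    ((q : ℕ) : 𝓞 F) ∈ (w.under (𝓞 F)).asIdeal := by
  rw [HeightOneSpectrum.under_asIdeal, Ideal.under, Ideal.mem_comap, map_natCast]
  exact hw

/-- **Unramified-above-`ℓ` sector: pinned geometricity restricts, for EVERY reciprocity datum of `E`.**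
If `ρ` is unramified almost everywhere and unramified at every `v ∣ ℓ`, then `ρ|_{Γ_E}` is
pinned-geometric over `E`: at `w ∣ ℓ`, `w ∣ v ∣ ℓ`, `ρ|_{Γ_E}` is unramified at `w`
(`FramedGaloisRep.isUnramifiedAt_restrictField`), hence locally unramified at `E_w`
(`isLocallyUnramified_toLocal_of_isUnramifiedAt`), hence de Rham for every datum (structure axiom
`isDeRhamWith_of_isLocallyUnramified`: unramified ⇒ crystalline ⇒ de Rham, Fontaine 1994 Exp. III §5).
[cite: FontaineAsterisque223III, §5] [cite: SerreAbelianLadic1968, Ch. I §2.1] -/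
theorem isGeometricFramed_restrictField_of_isUnramifiedAt_above (E : Type) [Field E] [NumberField E]
    [Algebra F E] (ρ : FramedGaloisRep F (PadicAlgCl ℓ) n)
    (hunr : ∀ᶠ v : HeightOneSpectrum (𝓞 F) in cofinite, ρ.IsUnramifiedAt v)
    (habove : ∀ v : HeightOneSpectrum (𝓞 F), ((ℓ : ℕ) : 𝓞 F) ∈ v.asIdeal → ρ.IsUnramifiedAt v)
    (R' : ReciprocityData E) : IsGeometricFramed R' (ρ.restrictField E) :=
  ⟨eventually_isUnramifiedAt_restrictField E ρ hunr, fun w hw ↦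
    (R'.pst ℓ w hw).isDeRhamFramed_of_isLocallyUnramified
      (isLocallyUnramified_toLocal_of_isUnramifiedAt _ w
        (ρ.isUnramifiedAt_restrictField (v := w.under (𝓞 F)) rfl
          (habove _ (natCast_mem_under E w hw))))⟩

/-- **STUB 5E on the unramified-above-`ℓ` sector** (the registered signature of
`stub_exists_goodCMQuadratic` with the extra hypothesis "`ρ` unramified at every `v ∣ ℓ`"), for every
datum, without `FontaineDatumExists`. [cite: FontaineAsterisque223III, §5] [cite: Clifford1937, Thm. 1] -/
theorem stub_exists_goodCMQuadratic_of_isUnramifiedAt_above : ∀ (F : Type) [Field F] [NumberField F], NumberField.IsTotallyReal F → ∀ (R : ReciprocityData F) (n : ℕ), 0 < n → ∀ (ℓ : ℕ) [Fact ℓ.Prime] (ρ : Literature.NumberTheory.GaloisRepresentations.FramedGaloisRep F (PadicAlgCl ℓ) n), ρ.toGaloisRep.IsIrreducible → IsGeometricFramed R ρ → (∀ v : HeightOneSpectrum (𝓞 F), ((ℓ : ℕ) : 𝓞 F) ∈ v.asIdeal → ρ.IsUnramifiedAt v) → ∃ (E : Type) (_ : Field E) (_ : NumberField E) (_ : Algebra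 F E) (_ : IsGalois F E), Module.finrank F E = 2 ∧ NumberField.IsCMField E ∧ (ρ.restrictField E).toGaloisRep.IsIrreducible ∧ ∀ R' : ReciprocityData E, IsGeometricFramed R' (ρ.restrictField E) := by
  intro F _ _ hF R n hn ℓ _ ρ hirr hgeo habove
  obtain ⟨i, hi⟩ :=
    exists_goodPrime_isIrreducible_restrictField hn ρ hirr 1 one_ne_zero ∅ Set.finite_empty
  exact ⟨sqrtNegField F i.1, inferInstance, inferInstance, inferInstance, inferInstance,
    finrank_sqrtNegField, i.isCMField (Or.inl hF), hi,
    isGeometricFramed_restrictField_of_isUnramifiedAt_above _ ρ hgeo.1 habove⟩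

/-- **STUB 5E from the missing de Rham base-change lemma for the pinned datum.**  The FULL registered
signature of `stub_exists_goodCMQuadratic` follows from ONE explicit hypothesis `hdR` — "for a finite
extension `E/F` of number fields and `ρ : Γ_F → GL_n(ℚ̄_ℓ)`: de Rham at every `v ∣ ℓ` for
`fontainePstAdicCompletion v ℓ hv` (period ring `B_dR(F_v)`) ⇒ de Rham at every `w ∣ ℓ` for
`fontainePstAdicCompletion w ℓ hw` (`B_dR(E_w)`) after restriction to `Γ_E`" (Fontaine 1994, Exp. III
§1.5, §3: `B_dR` depends only on `ℂ_ℓ`, and `B_dR`-admissibility is insensitive to restriction to an open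
subgroup) — which the tree cannot state a proof of today: no comparison between the period-ring data of
`E_w` and `F_v`, nor between `Γ_{E_w} → Γ_E → Γ_F` and `Γ_{E_w} → Γ_{F_v} → Γ_F`, exists (the formal
residue of 5E; definition item `defn-FontainePstWeilDeligneData`).  Everything else is proved above.
[cite: FontaineAsterisque223III, Exp. III §1.5 and §3] [cite: FontaineMazurGeometric1995, §1] -/
theorem stub_exists_goodCMQuadratic_of_deRhamRestriction
    (hdR : ∀ (F : Type) [Field F] [NumberField F] (E : Type) [Field E] [NumberField E] [Algebra F E]
      (ℓ : ℕ) [Fact ℓ.Prime] (n : ℕ) (ρ : FramedGaloisRep F (PadicAlgCl ℓ) n),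
      (∀ (v : HeightOneSpectrum (𝓞 F)) (hv : ((ℓ : ℕ) : 𝓞 F) ∈ v.asIdeal),
          (fontainePstAdicCompletion v ℓ hv).IsDeRhamFramed (ρ.toLocal v)) →
        ∀ (w : HeightOneSpectrum (𝓞 E)) (hw : ((ℓ : ℕ) : 𝓞 E) ∈ w.asIdeal),
          (fontainePstAdicCompletion w ℓ hw).IsDeRhamFramed ((ρ.restrictField E).toLocal w)) :
    ∀ (F : Type) [Field F] [NumberField F], NumberField.IsTotallyReal F → ∀ (R : ReciprocityData F) (n : ℕ), 0 < n → ∀ (ℓ : ℕ) [Fact ℓ.Prime] (ρ : Literature.NumberTheory.GaloisRepresentations.FramedGaloisRep F (PadicAlgCl ℓ) n), ρ.toGaloisRep.IsIrreducible → IsGeometricFramed R ρ → ∃ (E : Type) (_ : Field E) (_ : NumberField E) (_ : Algebra F E) (_ : IsGalois F E), Module.finrank F E = 2 ∧ NumberField.IsCMField E ∧ (ρ.restrictField E).toGaloisRep.IsIrreducible ∧ ∀ R' : ReciprocityData E, IsGeometricFramed R' (ρ.restrictField E) := by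
  intro F _ _ hF R n hn ℓ _ ρ hirr hgeo
  obtain ⟨i, hi⟩ :=
    exists_goodPrime_isIrreducible_restrictField hn ρ hirr 1 one_ne_zero ∅ Set.finite_empty
  exact ⟨sqrtNegField F i.1, inferInstance, inferInstance, inferInstance, inferInstance,
    finrank_sqrtNegField, i.isCMField (Or.inl hF), hi, fun R' ↦
      ⟨eventually_isUnramifiedAt_restrictField _ ρ hgeo.1,
        hdR F (sqrtNegField F i.1) ℓ n ρ hgeo.2⟩⟩

end Geometric

end Summit.Langlands.Langlands.Theorems.ReciprocityTRCM

end
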